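import Summits.ResolutionOfSingularities.ResolutionOfSingularities.Theorems.FrobeniusClosingPatchingRelPerfectDepthWeightTwoBNrLoopCJS
import Literature.Topology.KrullDimensionDrop
import HarnessLib

/-!
# Crux `PatchingRelPerfect` (stmt-ResolutionOfSingularities-16161), chain W5.2 — F5c / TargetsF5c T5-E^nr «W₂B WITHOUT REDUCEDNESS»:
# the FRONT HALF of the target — CJS (F-32bR) + the reducedness-free transport, up to the CJS end clauses

[OURS · L1 W5.2 · TargetsF5c T5-E^nr (res-L1-w52-plan-1 STEER 4/5; owner res-D-pv-052 AS res-L1-w52-stub-7).]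
NOT statements of the manuscript under review (Hironaka 2017); AI-written, weaker than expert review.  The F-32bR named fact
`CossartJannsenSaito2020EmbeddedSequenceB` is a HYPOTHESIS (exactly as inside the target `WeightTwoBoundaryJRnr₃`), never asserted.

`Nr.transport_cjs_end`: for ANY non-zero locally principal `𝔟` on an integral Noetherian regular excellent scheme `E` of dimension
three, F-32bR's embedded sequence over `X := Supp 𝔟` (closed, `≠ E`, of dimension `≤ 2`) transported by `Nr.cjs_transport`
(p529202) yields an `IsWeightedSeqJR 2` sequence from `(𝔟, 𝔟, [], [])` to a state `StateNr 𝔟' D' ℬ' 𝒟'` on `E' ≅ Z₁` TOGETHER WITH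
the CJS end clauses read on `Z₁`: `X₁` closed, `𝓘(cl X₁)` with regular zero-scheme, `X₁` transversal to `B₁`, `Supp D' = e⁻¹(cl X₁)`,
boundary supports inside `e⁻¹ B₁` — the exact input of the END^nr (res-D-pv-055's end package: factorisation of the final host into
its regular pairwise-disjoint components with exponents; res-L1-w52-stub-1's peel loop `isWeightedSeqJR_peel` p527073, one weight-two
peel per component of exponent `≥ 2`; then `EndStateJR`).  This is res-D-pv-054's `WeightTwoB.weightTwoBoundaryJR` (…DepthWeightTwoBCJS
l.195–226) up to, and excluding, `StateIn.endClauses` — with `IsReduced 𝔟.subscheme` gone.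

## References
* V. Cossart, U. Jannsen, S. Saito, LNM 2270 (2020), Thm. 1.4, Thm. 6.9 (a), p. 7. [CossartJannsenSaito2020]
* J. Kollár, *Lectures on Resolution of Singularities* (2007), (3.111) Steps 1–3. [Kollar2007]
-/

-- `Summit.<Summit>.<Sub>.Theorems` with `Sub = Summit` (single-conjunct summit, D-0017)
set_option linter.dupNamespace false

noncomputable section

open CategoryTheory CategoryTheory.Limits AlgebraicGeometry TopologicalSpace IsLocalRing
open Literature.AlgebraicGeometry.Resolution Scheme.IdealSheafData

namespace Summit.ResolutionOfSingularities.ResolutionOfSingularities.Theorems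

universe u

namespace WeightTwoB

namespace Nr

open DepthSNC DepthTargets

/-- [OURS · L1 W5.2] **T5-E^nr, FRONT HALF** (modulo F-32bR as a hypothesis): CJS's embedded sequence over `Supp 𝔟` transported
without reducedness — an `IsWeightedSeqJR 2` sequence from `(𝔟, 𝔟, [], [])`, the final `StateNr`, and the CJS END CLAUSES on
`Z₁` (closed `X₁`, regular `V(𝓘(cl X₁))`, `X₁ ⋔ B₁`, `Supp D' = e⁻¹(cl X₁)`, boundary over `B₁`).
[cite: CossartJannsenSaito2020, Thm. 1.4, Thm. 6.9 (a)] [cite: Kollar2007, (3.111) Step 1] -/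
theorem transport_cjs_end (hCJS : CossartJannsenSaito2020EmbeddedSequenceB.{u})
    (E : Scheme.{u}) [IsIntegral E] [IsNoetherian E] (hreg : Scheme.IsRegular E) (hexc : Scheme.IsExcellent E)
    (hdim : topologicalKrullDim E = 3) (𝔟 : E.IdealSheafData) (h𝔟 : 𝔟 ≠ ⊥) (hlp : IsLocallyPrincipal 𝔟) :
    ∃ (Z₁ : Scheme.{u}) (X₁ B₁ : Set Z₁) (E' : Scheme.{u}) (_ : IsIntegral E') (_ : IsNoetherian E') (_ : IsNoetherian Z₁)
      (ρ : E' ⟶ E) (e : E' ≅ Z₁) (𝔟' D' : E'.IdealSheafData) (ℬ' 𝒟' : List (E'.IdealSheafData × ℕ)),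
      IsWeightedSeqJR 2 ρ 𝔟 𝔟 [] [] 𝔟' D' ℬ' 𝒟' ∧ StateNr 𝔟' D' ℬ' 𝒟' ∧
        IsClosed X₁ ∧ Scheme.IsRegular (vanishingIdeal ⟨closure X₁, isClosed_closure⟩).subscheme ∧
        IsTransversalWith Z₁ X₁ B₁ ∧
        ((D'.support : Set E') = e.hom ⁻¹' closure X₁) ∧ (∀ p ∈ ℬ', (p.1.support : Set E') ⊆ e.hom ⁻¹' B₁) := by
  -- `X = Supp 𝔟` is closed, `≠ E`, of dimension `≤ 2`
  set X : Set E := (𝔟.support : Set E) with hXdef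
  have hXc : IsClosed X := 𝔟.support.isClosed
  have hXne : X ≠ Set.univ := fun hX =>
    not_mem_support_genericPoint h𝔟 (show genericPoint E ∈ X from hX ▸ Set.mem_univ _)
  have hdimX : topologicalKrullDim X ≤ 2 := by
    have hlt := Literature.Topology.topologicalKrullDim_lt_of_isClosed_ssubset hXc hXne (2 + 1)
      (by rw [hdim]; exact_mod_cast (by norm_num : (3 : ℕ) < 2 + 1 + 1))
    rw [Nat.cast_add_one] at hlt
    exact_mod_cast (ENat.WithBot.lt_add_one_iff.mp hlt)
  -- CJS: the `𝓑`-permissible sequence over `X` and its end clauses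
  obtain ⟨Z₁, π, X₁, B₁, hT, -, -, -, -, hX₁, -, -, htr⟩ := hCJS.of_isClosed E hreg hexc X hXc hdimX
  -- transport (no reducedness)
  obtain ⟨hX₁c, E', hint, hnoeth, hnoethZ, ρ, e, 𝔟', D', ℬ', 𝒟', hseq, S, hsupp, hbd⟩ :=
    Nr.cjs_transport hreg 𝔟 h𝔟 hlp hT
  exact ⟨Z₁, X₁, B₁, E', hint, hnoeth, hnoethZ, ρ, e, 𝔟', D', ℬ', 𝒟', hseq, S, hX₁c, hX₁, htr, hsupp, hbd⟩

end Nr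

end WeightTwoB

end Summit.ResolutionOfSingularities.ResolutionOfSingularities.Theorems

end
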